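import Literature.MathematicalPhysics.QuantumFieldTheory.Balaban1983to89.B16RLeafRecord13LiveCoPH
import Literature.MathematicalPhysics.QuantumFieldTheory.Balaban1983to89.Node00.Record13SepCoPHChi
import Literature.MathematicalPhysics.QuantumFieldTheory.Balaban1983to89.Node00.Record13ResidualsRChi
import Literature.MathematicalPhysics.QuantumFieldTheory.Balaban1983to89.B16RLeafRecord13LiveChi
import Literature.MathematicalPhysics.QuantumFieldTheory.Balaban1983to89.B16RLeafRecord13LiveRstepChi
import Literature.MathematicalPhysics.QuantumFieldTheory.Balaban1983to89.B16RLeafRecord13LiveGenericZSChi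
import Literature.MathematicalPhysics.QuantumFieldTheory.Balaban1983to89.B16RLeafRecord13AtLiveChi
import Literature.MathematicalPhysics.QuantumFieldTheory.Balaban1983to89.Node00.Record13LiveSelectorChi

/-!
# χ-GENERIC RE-ISSUE (WORK ORDER RC-1 «RE-CENTRE THE RECORD», director-ym №462 (B) ∕ №467 (D)) of `B16RLeafRecord13LiveCoPH`

Cell `pub-ymgap` (HUMAN RULING D-0062, Track A), seat `pub-ymgap-dag-n11-d` (N11 [B14] s2; N11-σ campaign, `N11-G44-RC1-REACH-CENSUS.md`).  The CENTRE-TYPED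
declarations of `B16RLeafRecord13LiveCoPH` (those whose statement reads the (2.9) cut-off centre through `gOfRecord₁₃ ∕ EOfRecord₁₃ ∕ Provisos₁₃… ∕ T∕SLaw₁₃… ∕
UbgOfRecord₁₃… ∕ WtOfRecord₁₃… ∕ datum∕tower∕coreOfRecord₁₃…`) RE-ISSUED VERBATIM in the β-slot `χ : ChiSlot F N` over [Ax-3b]∕[Ax-3c]∕[Ax-3d]'s χ-generic carriers
(`Node00/Record13Chi` ∕ `Record13CoPHChi` ∕ `Record13SepCoPHChi`): σ = (binder `(χ : ChiSlot F N)` after `θ`; Node00 defs `X ↦ XChi … χ`; Node00 rows `Y ↦ Y_chi`;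
this lane's sibling modules `…Chi` for Summits-side dependencies); SAME short names in the sibling namespace `…B16RLeafRecord13LiveCoPHChi` (consumers switch by namespace);
the 29 centre-FREE declarations of the original are NOT copied — they are reused BY NAME (`open … (…)` below).  At `χ := chiβOfRecord₁₃ θ` every statement here is
EQUIVALENT to the landed one — NOT definitionally (v1.2 correction, after dag-ref-J READ-699 NIT 1 of substance on this lane's `…N11K1ZBRoadDoorRowsChi`, UPHELD): the χ-generic
carriers that are `def`s agree with the record's by `rfl` ([Ax-3b]∕[Ax-3c] §R receipts, e.g. `coreOfRecord₁₃CoPHChi_chiβ`, `WtOfRecord₁₃HChi_chiβ`), but the Prop-STRUCTURE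
`Stage13HParams.Provisos₁₃CoPHChi` ([Ax-3c] :140) is a distinct inductive type bridged only by the field-wise receipt `provisos₁₃CoPHChi_chiβ_iff`, so a statement binding
`(h : θ.Provisos₁₃CoPHChi F N χ)` meets its original after transporting `h` through that `Iff` (the datum∕tower are then `rfl`: `datumOfRecord₁₃CoPHChi_chiβ`); no consumer needs the
transport (the K1ᴬ machine reads the Ax slot); at `χ := chiβOfRecord₁₃Ax θ` it is what the Ax-record's N11 machine reads.  Nothing of record edited (body-freeze №460 (2)).

HONEST FRAMING.  Count-neutral kernel re-elaboration of landed N11 bookkeeping∕estimates in a parameter; every HYPOTHESIS of the original stays a hypothesis; nothing of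
Bałaban asserted beyond what the original file proves; N11 NOT discharged; K-items untouched; counts unmoved.  One finite `𝕋⁴_{L^K}` programme at fixed `ε = L^{−K}` —
NOT ℝ⁴, NOT OS, NOT a mass gap, NOT Clay.  No `sorry`∕`instance`∕`notation`.  Sources: as the original module, plus [I] = [Balaban1987RG1] (2.9) p.266 (the cut-off's centre).
-/
noncomputable section

open MeasureTheory
open scoped BigOperators Matrix.Norms.L2Operator

namespace Literature.MathematicalPhysics.QuantumFieldTheory.Balaban1983to89.B16RLeafRecord13LiveCoPHChi

open Literature.MathematicalPhysics.QuantumFieldTheory.Balaban1983to89.B16RLeafRecord13LiveCoPH (laws₁₃CoPH_of_liveSel_of_rstep rOperation_leavesP_of_liveSel₁₃CoPH_of_rstep sLaw₁₃CoPH_all_of_laws sLaw₁₃CoPH_all_of_thmP245_of_liveSel_of_rstep sLaw₁₃CoPH_all_of_thmP245LiveSeq_of_liveSel_of_rstep slotsT_succ_aeForm_of_sLaw₁₃CoPH_succ_of_liveSel_of_rstep sLaw₁₃CoPH_succ_clause_of_Omega_empty_of_liveSel_of_rstep laws₁₃CoPH_of_liveSel_of_hasResiduals rOperation_leavesP_of_liveSel₁₃CoPH_of_hasResiduals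 sLaw₁₃CoPH_all_of_thmP245_of_liveSel_of_hasResiduals slotsT_succ_aeForm_of_sLaw₁₃CoPH_succ_of_liveSel_of_hasResiduals sLaw₁₃CoPH_succ_clause_of_Omega_empty_of_liveSel_of_hasResiduals laws₁₃CoPH_liveRepin₁₃_of_hasResiduals rOpLeaf_VOfRecord₁₃CoPH_theta13LiveOfNumerics laws₁₃CoPH_theta13LiveOfNumerics rOpLeaf_VOfRecord₁₃CoPH_theta13LiveOfRecord laws₁₃CoPH_theta13LiveOfRecord rOperation_leavesP_theta13LiveOfRecord_CoPH slotsT_succ_aeForm_of_sLaw₁₃CoPH_succ_theta13LiveOfRecord rOpLeaf_VOfRecord₁₃CoPH_theta13OfThm1CC1 densitiesDescribed_leavesP_iff_sLaw₁₃CoPH_all densitiesDescribed_leavesP_iff_sLaw₁₃CoPH_all_datum densitiesDescribed_at_record₁₃CoPH_of_laws b14_main_at_record₁₃CoPH_of_rOpLeaf b14_main_at_record₁₃CoPH_of_liveSel b14_main_of_isRecordOfRecord₁₃CCoPH_datum_of_liveSel thm1Printed_datumOfRecord₁₃CoPH_of_laws_of_liveSel sLaw₁₃CoPH_succ_clause_of_Omega_empty_of_densitiesDescribed_of_liveSel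 densitiesDescribed_of_isRecordOfRecord₁₃CCoPH_of_rOperation)
open T4Continuum T4DatumAssembly Node00 B14.Eq218Concrete DagBinding
open B16RLeafRecord11 B16RLeafRecord12 B16RLeafRecord12Live B16RLeafRecord12AtLive
open B16RLeafRecord13Live hiding dead_of_ppSel_succ_ne_of_liveSel gOfRecord₁₃_succ_nonneg ppSel_succ_idem_of_liveSel slotsOfRecord₁₃_succ_eq_zero_of_dead slotsOfRecord₁₃_succ_eq_zero_of_not_mem_range slotsOfRecord₁₃_succ_eq_zero_of_slotsT_eq_zero
open B16RLeafRecord13LiveChi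
open B16RLeafRecord13AtLive hiding liveRepin₁₃_liveSel
open B16RLeafRecord13AtLiveChi
open B16RLeafRecord13LiveRstep hiding rstep₁₃_of_liveSel_of_hasResiduals slotsOfRecord₁₃_succ_ae_eq_slotsT_of_fix_of_dead_of_rstep
open B16RLeafRecord13LiveRstepChi
open B16RLeafRecord13LiveGenericZS hiding hasSect2FormAEZS_succ_of_TAEZS_of_idem_of_dead_of_rstep hasSect2FormAEZS_succ_of_TAEZS_of_liveSel_of_rstep slotClauseΦ_succ_of_slotTClauseΦ_of_idem_of_dead_of_rstep slotClauseΦ_succ_of_slotTClauseΦ_of_liveSel_of_rstep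
open B16RLeafRecord13LiveGenericZSChi
open B14NodeKnitTowerDatum (densitiesDescribed_iff_core b14_main_at_datumOfTower_of_propTower)

variable (F : T4Family) (N : ℕ) [NeZero N]

/-! ## §1  Generic `θ : Stage13HParams` at the live selector: the chain AT v1.7 `CoPH` (residual `θ.rzAt p s`, weights `WtOfRecord₁₃H θ p s`, background `UbgOfRecord₁₃CoP`) from row `rstep`, and from `HasResidualsOfRecord` alone -/

section LiveSel

variable (θ : Stage13HParams F N) (χ : ChiSlot F N) (p : B12.RunParams)

/-- **`TLaw₁₃CoPH k → SLaw₁₃CoPH (k+1)` at the live selector from row `rstep`** (+ admissibility, signs): (G6″)'s forward step at `(Rz, W, U) := (θ.rzAtChi χ p, WtOfRecord₁₃H θ p, UbgOfRecord₁₃CoP θ.toStage13Params p (k+1))`.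
[cite: Balaban1988Convergent, §2 p.262, Thm 2 p.263, (3.24)–(3.25) p.270; Balaban1989LargeFieldI, (0.3) p.176, p.177 (i)–(ii)] -/
theorem sLaw₁₃CoPH_succ_of_tLaw₁₃CoPH_of_liveSel_of_rstep
    (hrstep : ∀ (p : B12.RunParams) (k : ℕ) [DecidableEq (PBond (F.P p.K) (k + 1))], k < p.K →
      (towerRepOfRecord F N θ.ν θ.τ9 (slotsTOfRecord F N θ.ν θ.τ9 (EOfRecord₁₃Chi F N θ.toStage13Params χ) (wOfRecord₉ F N θ.toStage9Params) θ.ppSel)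
        θ.ppSel p (gOfRecord₁₃Chi F N θ.toStage13Params χ p) (k + 1)).toRepData.ProvisosInt)
    (hθ : θ.Admissible F N) (hκ : 0 ≤ θ.s2.lf.κ) (hE₀ : 0 ≤ θ.s2.lf.E₀) (hB₀ : 0 ≤ θ.s2.lf.B₀)
    (hsel : θ.ppSel = ppSelLiveOfRecord F N θ.ν θ.τ9 (EOfRecord₁₃Chi F N θ.toStage13Params χ) (wOfRecord₉ F N θ.toStage9Params)) (k : ℕ) (hk : k < p.K) (hT : TLaw₁₃CoPHChi F N θ χ p k) : SLaw₁₃CoPHChi F N θ χ p (k + 1) :=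
  (sLaw₁₃CoPH_iff_chi F N θ χ p (k + 1)).mpr
    (hasSect2FormAEZS_succ_of_TAEZS_of_liveSel_of_rstep F N θ.toStage13Params χ p hrstep hθ hκ hE₀ hB₀ hsel k hk (θ.rzAtChi χ p) (WtOfRecord₁₃HChi F N θ χ p) (UbgOfRecord₁₃CoPChi F N θ.toStage13Params χ p (k + 1))
      ((tLaw₁₃CoPH_iff_chi F N θ χ p k).mp hT))

/-- **★★ THE 𝐑-LEAF OF RECORD AT v1.7 `CoPH`, `ROpLeaf (VOfRecord₁₃CoPH θ p)`, at the live selector from row `rstep`** (+ admissibility, signs) — N13's CoPH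
conjunct on the live line. [cite: Balaban1988Convergent, p.244, Thm 2 p.263; Balaban1989LargeFieldI, (0.3) p.176, p.177 (i)–(ii); Balaban1989LargeFieldII, Thm 1 p.355 (not exercised)] -/
theorem rOpLeaf_VOfRecord₁₃CoPH_of_liveSel_of_rstep
    (hrstep : ∀ (p : B12.RunParams) (k : ℕ) [DecidableEq (PBond (F.P p.K) (k + 1))], k < p.K →
      (towerRepOfRecord F N θ.ν θ.τ9 (slotsTOfRecord F N θ.ν θ.τ9 (EOfRecord₁₃Chi F N θ.toStage13Params χ) (wOfRecord₉ F N θ.toStage9Params) θ.ppSel)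
        θ.ppSel p (gOfRecord₁₃Chi F N θ.toStage13Params χ p) (k + 1)).toRepData.ProvisosInt)
    (hθ : θ.Admissible F N) (hκ : 0 ≤ θ.s2.lf.κ) (hE₀ : 0 ≤ θ.s2.lf.E₀) (hB₀ : 0 ≤ θ.s2.lf.B₀)
    (hsel : θ.ppSel = ppSelLiveOfRecord F N θ.ν θ.τ9 (EOfRecord₁₃Chi F N θ.toStage13Params χ) (wOfRecord₉ F N θ.toStage9Params)) : ROpLeaf (VOfRecord₁₃CoPHChi F N θ χ p) :=
  (rOpLeaf_VOfRecord₁₃CoPH_iff_chi F N θ χ p).mpr fun k hk hT =>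
    sLaw₁₃CoPH_succ_of_tLaw₁₃CoPH_of_liveSel_of_rstep F N θ χ p hrstep hθ hκ hE₀ hB₀ hsel k hk hT

/-- **★★ THE CoPH 𝐑-LEAF AT THE LIVE SELECTOR FROM K0b's `HasResidualsOfRecord` ALONE** (+ admissibility, signs; NO proviso field).
[cite: Balaban1988Convergent, p.244, Thm 2 p.263, (3.16) p.268; Balaban1989LargeFieldI, (0.3)–(0.4) p.176, p.177 (i)–(ii); Balaban1989LargeFieldII, Thm 1 p.355 (not exercised)] -/
theorem rOpLeaf_VOfRecord₁₃CoPH_of_liveSel_of_hasResiduals (hres : θ.HasResidualsOfRecord F N) (hθ : θ.Admissible F N) (hκ : 0 ≤ θ.s2.lf.κ) (hE₀ : 0 ≤ θ.s2.lf.E₀) (hB₀ : 0 ≤ θ.s2.lf.B₀)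
    (hsel : θ.ppSel = ppSelLiveOfRecord F N θ.ν θ.τ9 (EOfRecord₁₃Chi F N θ.toStage13Params χ) (wOfRecord₉ F N θ.toStage9Params)) : ROpLeaf (VOfRecord₁₃CoPHChi F N θ χ p) :=
  rOpLeaf_VOfRecord₁₃CoPH_of_liveSel_of_rstep F N θ χ p (rstep₁₃_of_liveSel_of_hasResiduals hsel hres) hθ hκ hE₀ hB₀ hsel

end LiveSel

/-! ## §2  CLOSURES AT EVERY HISTORY-INDEXED EXTENSION `⟨⟨θ₀, Zr⟩, Zh, Phih⟩` OF K0a's RE-PIN AND WITNESSES (`Zr`, `Zh`, `Phih` free) -/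

section Repin

variable (θ : Stage13Params F N) (χ : ChiSlot F N) (Zr : (q : B12.RunParams) → TkResidualW F N (FluctV N) q.K) (Zh : (q : B12.RunParams) → ℕ → (ℕ → Set (Site (F.P q.K) 0)) → (ℕ → Set (Site (F.P q.K) 0)) → TkResidualW F N (FluctV N) q.K)
  (Phih : (q : B12.RunParams) → ℕ → (ℕ → Set (Site (F.P q.K) 0)) → (ℕ → Set (Site (F.P q.K) 0)) → (ℕ → Plaq (F.P q.K) 0 → ℝ)) (p : B12.RunParams)

/-- **★★ The CoPH 𝐑-leaf at the live re-pin of any `θ` carrying K0b's residuals** (admissibility, signs). [cite: Balaban1988Convergent, p.244, (3.16) p.268; Balaban1989LargeFieldI, (0.3)–(0.4) p.176, p.177 (i)–(ii); Balaban1989LargeFieldII, Thm 1 p.355 (not exercised)] -/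
theorem rOpLeaf_VOfRecord₁₃CoPH_liveRepin₁₃_of_hasResiduals (hres : θ.HasResidualsOfRecord F N) (hθ : θ.Admissible F N) (hκ : 0 ≤ θ.s2.lf.κ) (hE₀ : 0 ≤ θ.s2.lf.E₀) (hB₀ : 0 ≤ θ.s2.lf.B₀) :
    ROpLeaf (VOfRecord₁₃CoPHChi F N (⟨⟨θ.liveRepin₁₃Chi F N χ, Zr⟩, Zh, Phih⟩ : Stage13HParams F N) χ p) :=
  rOpLeaf_VOfRecord₁₃CoPH_of_liveSel_of_hasResiduals F N (⟨⟨θ.liveRepin₁₃Chi F N χ, Zr⟩, Zh, Phih⟩ : Stage13HParams F N) χ p (Stage13Params.HasResidualsOfRecord.liveRepin₁₃Chi hres) hθ.liveRepin₁₃Chi hκ hE₀ hB₀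
    (liveRepin₁₃_liveSel F N θ χ)

end Repin

/-! ## §3  NODE ∕ DATUM FACES AT THE v1.7 `CoPH` RECORD -/

/-! ## v1.1 (APPEND-ONLY; dag-n11-d g44, N11-σ chain): the remaining cone declarations of this module in χ — every v1 declaration above is byte-identical -/

/-! ### v1.2 (DOCSTRINGS ONLY; dag-n11-d g45): dag-ref-I READ-1026 NIT N1 — the docstring of `b14_main_at_record₁₃CoPH_of_rOpLeaf` now names the χ-tower
`towerOfRecord₁₃CoPHChi F N θ χ h` its statement uses (was the σ-source name); header sentence «DEFINITIONALLY the landed one» corrected to «EQUIVALENT … field-wise Iff»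
(dag-ref-J READ-699's upheld NIT, fixed lane-wide with each module's next edition).  Every declaration, statement AND proof, is byte-identical to v1.1 (✓p813811). -/

section V11Append

open Literature.MathematicalPhysics.QuantumFieldTheory.Balaban1983to89.B16RLeafRecord13LiveCoPH (laws₁₃CoPH_of_liveSel_of_rstep rOperation_leavesP_of_liveSel₁₃CoPH_of_rstep sLaw₁₃CoPH_all_of_laws sLaw₁₃CoPH_all_of_thmP245_of_liveSel_of_rstep sLaw₁₃CoPH_all_of_thmP245LiveSeq_of_liveSel_of_rstep slotsT_succ_aeForm_of_sLaw₁₃CoPH_succ_of_liveSel_of_rstep sLaw₁₃CoPH_succ_clause_of_Omega_empty_of_liveSel_of_rstep laws₁₃CoPH_of_liveSel_of_hasResiduals rOperation_leavesP_of_liveSel₁₃CoPH_of_hasResiduals sLaw₁₃CoPH_all_of_thmP245_of_liveSel_of_hasResiduals slotsT_succ_aeForm_of_sLaw₁₃CoPH_succ_of_liveSel_of_hasResiduals sLaw₁₃CoPH_succ_clause_of_Omega_empty_of_liveSel_of_hasResiduals laws₁₃CoPH_liveRepin₁₃_of_hasResiduals rOpLeaf_VOfRecord₁₃CoPH_theta13LiveOfNumerics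 laws₁₃CoPH_theta13LiveOfNumerics rOpLeaf_VOfRecord₁₃CoPH_theta13LiveOfRecord laws₁₃CoPH_theta13LiveOfRecord rOperation_leavesP_theta13LiveOfRecord_CoPH slotsT_succ_aeForm_of_sLaw₁₃CoPH_succ_theta13LiveOfRecord rOpLeaf_VOfRecord₁₃CoPH_theta13OfThm1CC1 densitiesDescribed_leavesP_iff_sLaw₁₃CoPH_all densitiesDescribed_leavesP_iff_sLaw₁₃CoPH_all_datum densitiesDescribed_at_record₁₃CoPH_of_laws b14_main_at_record₁₃CoPH_of_liveSel b14_main_of_isRecordOfRecord₁₃CCoPH_datum_of_liveSel thm1Printed_datumOfRecord₁₃CoPH_of_laws_of_liveSel sLaw₁₃CoPH_succ_clause_of_Omega_empty_of_densitiesDescribed_of_liveSel densitiesDescribed_of_isRecordOfRecord₁₃CCoPH_of_rOperation)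

section
variable (F : T4Family) (N : ℕ) [NeZero N]
variable (θ : Stage13HParams F N) (χ : ChiSlot F N) (p : B12.RunParams)
variable (θ : Stage13Params F N) (χ : ChiSlot F N) (Zr : (q : B12.RunParams) → TkResidualW F N (FluctV N) q.K) (Zh : (q : B12.RunParams) → ℕ → (ℕ → Set (Site (F.P q.K) 0)) → (ℕ → Set (Site (F.P q.K) 0)) → TkResidualW F N (FluctV N) q.K)
variable (θ : Stage13HParams F N) (χ : ChiSlot F N) (p : B12.RunParams) (w : WorldP)
variable (h : θ.Provisos₁₃CoPHChi F N χ)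

/-- **N11 · `Dag.B14_main (leavesP w P)` AT A CoPH-DATUM WORLD, 𝐑 READ THROUGH THE LEAF, ONE DISPLAYED SLOT (S1ᵀ)** (n11-a's `b14_main_at_datumOfTower_of_propTower` at the CoPH core
and `towerOfRecord₁₃CoPHChi F N θ χ h`; START `sLaw₁₃CoPH_zero_chi`). [cite: Balaban1988Convergent, Thm 1 p.262; Theorem p.245; p.244] -/
theorem b14_main_at_record₁₃CoPH_of_rOpLeaf (hC : w.C = (datumOfRecord₁₃CoPHChi F N θ χ h).C)
    (hV : (leavesP w p).rOperation → ROpLeaf (VOfRecord₁₃CoPHChi F N θ χ p))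
    (hT : (leavesP w p).b7 → (leavesP w p).b8 → (leavesP w p).b9 → (leavesP w p).b10 → (leavesP w p).b11 →
      (leavesP w p).smallCouplings → (leavesP w p).smallFieldInductive → (leavesP w p).flowControl →
        ∀ k, k < p.K → SLaw₁₃CoPHChi F N θ χ p k → TLaw₁₃CoPHChi F N θ χ p k) :
    Dag.B14_main (leavesP w p) :=
  b14_main_at_datumOfTower_of_propTower F N (coreOfRecord₁₃CoPHChi F N θ χ) (towerOfRecord₁₃CoPHChi F N θ χ h) w p hC
    (SLaw₁₃CoPHChi F N θ χ p) (TLaw₁₃CoPHChi F N θ χ p) (fun _ _ hS => hS) (fun _ => sLaw₁₃CoPH_zero_chi F N θ χ p) hT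
    (fun hrop => (rOpLeaf_VOfRecord₁₃CoPH_iff_chi F N θ χ p).1 (hV hrop))

end

end V11Append

end Literature.MathematicalPhysics.QuantumFieldTheory.Balaban1983to89.B16RLeafRecord13LiveCoPHChi

end

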